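import Mathlib
import Literature.NumberTheory.Automorphic.HilbertModularFormQExpansion
import Summits.Langlands.Langlands.Theorems.CapacityClassicalityHilbertIntegralOverconvergentIsCongruenceHilbertQExpansionRing
import Summits.Langlands.Langlands.Theorems.CapacityClassicalityHilbertIntegralOverconvergentIsCongruenceStubGradedSpanAxioms
import Summits.Langlands.Langlands.Theorems.CapacityClassicalityHilbertIntegralOverconvergentIsCongruenceStubRationalFamilyAxioms

/-!
# The `p`-adic graded family of the engine instance satisfies the engine's family axioms (section Q endpoint)

Endpoint of RESHAPE 13 (section Q) of line Sketch-ideate-r1-k1 for the crux `HilbertIntegralOverconvergentIsCongruence`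
(stmt-Langlands-8485): `engineFamilyAxioms` — for `F` totally real, `[F:ℚ] ≥ 2`, `𝔫 ≠ 0`, a number field `E` with
`τ : E →+* ℂ` and `v : E →+* ℚ̄_p` (`PadicAlgCl p`), let `enc` be the injective graded `q`-expansion map of
`hilbertQExpansionRing` and
`V b := span_{ℚ̄_p} {MvPowerSeries.map v A | A : MvPowerSeries (Fin d) E, MvPowerSeries.map τ A = enc f, f ∈ M_b(Γ₁(𝔫))}`.
Then `V` satisfies the five family hypotheses `hV1`, `hV0`, `hVadd`, `hVsmul`, `hVmul` of the landed `d`-free algebraization engine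
`stub_abstractEngineMain` (`stub_rationalFamily_axioms`: the `E`-rational encoded `q`-expansions contain `1` and are closed under graded
products; `stub_gradedSpan_axioms`: spans of such a family).  This is the object about which the crux's remaining named facts
(Hilbert Sturm bound for `V`, integral structure / Siegel count for the `E`-structure) are to be stated.
-/

set_option linter.dupNamespace false

noncomputable section

namespace Summit.Langlands.Langlands.Theorems.HilbertIntegralOverconvergentIsCongruence

open MeasureTheory Complex NumberField
open Literature.NumberTheory.Automorphic Literature.NumberTheory.Automorphic.HilbertModular

/-- **The `p`-adic graded family of Hilbert `q`-expansions satisfies the engine's family axioms**: see the module docstring.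
[folklore] -/
theorem engineFamilyAxioms (F : Type) [Field F] [NumberField F] [NumberField.IsTotallyReal F]
    (hd : 1 < Module.finrank ℚ F) (𝔫 : Ideal (𝓞 F)) (h𝔫 : 𝔫 ≠ ⊥) (E : Type) [Field E] [NumberField E] (τ : E →+* ℂ)
    (p : ℕ) [Fact p.Prime] (v : E →+* PadicAlgCl p) :
    ∃ (d : ℕ) (idx : F → (Fin d →₀ ℕ)) (enc : (Point F → ℂ) → MvPowerSeries (Fin d) ℂ)
      (V : ((F →+* ℝ) → ℤ) → Set (MvPowerSeries (Fin d) (PadicAlgCl p))),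
      Set.InjOn idx (qIndexSet F) ∧ (∀ μ ∈ qIndexSet F, ∀ μ' ∈ qIndexSet F, idx (μ + μ') = idx μ + idx μ') ∧
      (∀ f : Point F → ℂ, (∀ μ ∈ qIndexSet F, MvPowerSeries.coeff (idx μ) (enc f) = fourierCoeff f μ) ∧
          ∀ n, (∀ μ ∈ qIndexSet F, idx μ ≠ n) → MvPowerSeries.coeff n (enc f) = 0) ∧
      (∀ (k k' : (F →+* ℝ) → ℤ) (f g : Point F → ℂ), f ∈ modularForms (Bianchi.Gamma1 𝔫) k →
          g ∈ modularForms (Bianchi.Gamma1 𝔫) k' → enc f = enc g → f = g) ∧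
      (∀ (k k' : (F →+* ℝ) → ℤ) (f g : Point F → ℂ), f ∈ modularForms (Bianchi.Gamma1 𝔫) k →
          g ∈ modularForms (Bianchi.Gamma1 𝔫) k' → enc (f * g) = enc f * enc g) ∧
      (∀ (k : (F →+* ℝ) → ℤ) (f g : Point F → ℂ), f ∈ modularForms (Bianchi.Gamma1 𝔫) k →
          g ∈ modularForms (Bianchi.Gamma1 𝔫) k → enc (f + g) = enc f + enc g) ∧
      (∀ (k : (F →+* ℝ) → ℤ) (c : ℂ) (f : Point F → ℂ), f ∈ modularForms (Bianchi.Gamma1 𝔫) k →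
          enc (c • f) = c • enc f) ∧
      ((halfSpace F).indicator (fun _ ↦ (1 : ℂ)) ∈ modularForms (Bianchi.Gamma1 𝔫) 0 ∧
          enc ((halfSpace F).indicator (fun _ ↦ (1 : ℂ))) = 1) ∧
      (∀ b φ, φ ∈ V b ↔ φ ∈ (Submodule.span (PadicAlgCl p)
          {ψ | ∃ (A : MvPowerSeries (Fin d) E) (f : Point F → ℂ), f ∈ modularForms (Bianchi.Gamma1 𝔫) b ∧
            MvPowerSeries.map τ A = enc f ∧ ψ = MvPowerSeries.map v A} : Set (MvPowerSeries (Fin d) (PadicAlgCl p)))) ∧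
      (1 : MvPowerSeries (Fin d) (PadicAlgCl p)) ∈ V 0 ∧ (∀ b, (0 : MvPowerSeries (Fin d) (PadicAlgCl p)) ∈ V b) ∧
      (∀ b φ ψ, φ ∈ V b → ψ ∈ V b → φ + ψ ∈ V b) ∧ (∀ b (c : PadicAlgCl p) φ, φ ∈ V b → c • φ ∈ V b) ∧
      ∀ b₁ b₂ φ ψ, φ ∈ V b₁ → ψ ∈ V b₂ → φ * ψ ∈ V (b₁ + b₂) := by
  obtain ⟨d, idx, enc, hinj, hadd, henc, hmul, haddenc, hsmul, hone, hinjenc⟩ := hilbertQExpansionRing F hd 𝔫 h𝔫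
  set S : ((F →+* ℝ) → ℤ) → Set (MvPowerSeries (Fin d) (PadicAlgCl p)) := fun b ↦
    {ψ | ∃ (A : MvPowerSeries (Fin d) E) (f : Point F → ℂ), f ∈ modularForms (Bianchi.Gamma1 𝔫) b ∧
      MvPowerSeries.map τ A = enc f ∧ ψ = MvPowerSeries.map v A} with hSdef
  obtain ⟨h1S, hmulS⟩ := stub_rationalFamily_axioms F 𝔫 d enc hmul hone E τ p v
  have h1 : (1 : MvPowerSeries (Fin d) (PadicAlgCl p)) ∈ S 0 := by
    obtain ⟨A, f, hf, hA, h1⟩ := h1S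
    exact ⟨A, f, hf, hA, h1⟩
  have hmul' : ∀ b₁ b₂, ∀ x ∈ S b₁, ∀ y ∈ S b₂, x * y ∈ S (b₁ + b₂) := fun b₁ b₂ x hx y hy ↦ hmulS b₁ b₂ x y hx hy
  obtain ⟨hV1, hV0, hVadd, hVsmul, hVmul⟩ :=
    stub_gradedSpan_axioms (PadicAlgCl p) ((F →+* ℝ) → ℤ) (MvPowerSeries (Fin d) (PadicAlgCl p)) S h1 hmul'
  exact ⟨d, idx, enc, fun b ↦ (Submodule.span (PadicAlgCl p) (S b) : Set (MvPowerSeries (Fin d) (PadicAlgCl p))),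
    hinj, hadd, henc, hinjenc, hmul, haddenc, hsmul, hone, fun b φ ↦ Iff.rfl, hV1, hV0, hVadd, hVsmul, hVmul⟩

end Summit.Langlands.Langlands.Theorems.HilbertIntegralOverconvergentIsCongruence
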